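import Mathlib

/-!
# Stub `stub_foldArith` (fold arithmetic) for line `Sketch` of crux `FemtoCurvatureTwoPointC`

Pure `ℕ` bookkeeping. On the torus of side `L`, a pair of plaquettes at largest coordinate
separation `m` (`1 ≤ m`, `2m ≤ L`) is controlled by diagonal covariances at lattice separations
`s = m - 1 + t`, `t ∈ {0, 1, 2}`, each folded by the torus symmetry to
`s' = min (s % L) (L - s % L)`. The bridge needs: either `s' = 0` (which forces `m = 1`), or
`1 ≤ s'`, `m ≤ 2 s'`, `s' ≤ 4 m` and `2 s' ≤ L`.

Proof: `s ≤ m + 1 ≤ 2 m ≤ L`, so either `s < L` (`Nat.mod_eq_of_lt`) or `s = L` (`Nat.mod_self`);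
in both cases the remaining goal is linear arithmetic with a `min`, closed by `omega`.
-/

set_option autoImplicit false

namespace Summit.QuantumFields.YangMills.Theorems.FemtoCurvatureTwoPointC

/-- **Fold arithmetic.** For the window `s ∈ {m−1, m, m+1}` (`1 ≤ m`, `2m ≤ L`) the folded separation
`s' = min (s % L) (L − s % L)` is either `0` (then `m = 1`) or satisfies `1 ≤ s'`, `m ≤ 2s'`, `s' ≤ 4m`, `2s' ≤ L`.
[folklore] -/
theorem stub_foldArith :
    ∀ (L m t : ℕ), 1 ≤ m → 2 * m ≤ L → t < 3 →
      (min ((m - 1 + t) % L) (L - (m - 1 + t) % L) = 0 ∧ m = 1) ∨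
      (1 ≤ min ((m - 1 + t) % L) (L - (m - 1 + t) % L) ∧
        m ≤ 2 * min ((m - 1 + t) % L) (L - (m - 1 + t) % L) ∧
        min ((m - 1 + t) % L) (L - (m - 1 + t) % L) ≤ 4 * m ∧
        2 * min ((m - 1 + t) % L) (L - (m - 1 + t) % L) ≤ L) := by
  intro L m t hm hL ht
  have hs : m - 1 + t ≤ L := by omega
  rcases Nat.lt_or_eq_of_le hs with h | h
  · rw [Nat.mod_eq_of_lt h]
    omega
  · rw [h, Nat.mod_self]
    omega

end Summit.QuantumFields.YangMills.Theorems.FemtoCurvatureTwoPointC
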